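import Summits.QuantumFields.YangMills.Theorems.EquipartitionCriticalityFreeEnergyLogCoefficientAbstractB
import HarnessLib

/-!
# The abstract joint limit, comparison lemmas and error majorants of the lower bound — crux `FreeEnergyLogCoefficient`, line `Sketch`, stub `abstractJointLimit` (part C)

S. Chatterjee, *The leading term of the Yang–Mills free energy*, J. Funct. Anal. 271 (2016),
arXiv:1602.01222, §17 (proof of Lemma 17.7), GROUP-FREE, for an abstract one-box interface
`B : OneBoxBounds d` (port of the middle part of the tree file
`Literature/MathematicalPhysics/QuantumFieldTheory/ChatterjeeFreeEnergyJointLimit.lean`):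

* `T_sub_le_T_of_le` (rounding the side length up, losing `K₃((n'-n)/n) log β`), `junk_le`,
  `T_sub_le_T_of_ge` (going down in the side length by **Lemma 17.5**);
* `common_err_le` (`coef(n) D log κ(r) + Aβr³d² ≤ e₀(β)` at `r = β^{-2/5}`), `tendsto_e0`,
  `tendsto_errLB`, `tendsto_JD` (the error majorants tend to `0`);
* `lowA` (**regime A**, `n ≤ β^c`: the union bound supplies the Gaussian small-ball probability).

## References

* S. Chatterjee, *The leading term of the Yang–Mills free energy*, J. Funct. Anal. 271 (2016)
  2944–3005, arXiv:1602.01222, §17 (Lemmas 17.5–17.7). [arXiv160201222]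
-/

noncomputable section

open scoped Matrix Matrix.Norms.Frobenius ENNReal NNReal
open MeasureTheory Measure Filter Topology Set
open Literature.Probability.LatticeModels Literature.MathematicalPhysics.QuantumLattice
open Literature.MathematicalPhysics.QuantumFieldTheory

namespace Summit.QuantumFields.YangMills.Theorems.FreeEnergyLogCoefficient

namespace OneBoxBounds

open ChatterjeeJointLimit WilsonWeakCoupling LatticeMaxwell ChatterjeeAssembly AxialGauge

variable {d : ℕ} (B : OneBoxBounds d)

/-! ### Lemma 17.7: comparison lemmas for the lower bound -/

/-- `K₃ ≥ 0`. [folklore] -/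
theorem K₃_nonneg : 0 ≤ B.K₃ := by
  unfold OneBoxBounds.K₃; have := B.Kc_nonneg; positivity

/-- **Rounding the side length up** (monotonicity of `Z` in the cube): for `β ≥ 2`, `1 ≤ n ≤ n' ≤ 2n`,
`T(B_n, β) ≥ T(B_{n'}, β) - K₃ ((n'-n)/n) log β`. [cite: arXiv160201222, Lemma 17.7 (proof)] -/
theorem T_sub_le_T_of_le (hd : 1 ≤ d) {β : ℝ} (hβ2 : 2 ≤ β) {n n' : ℕ} (hn : 1 ≤ n) (h1 : n ≤ n')
    (h2 : n' ≤ 2 * n) :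
    B.T n' β - B.K₃ * (((n' : ℝ) - n) / n) * Real.log β ≤ B.T n β := by
  have hβ0 : 0 < β := by linarith
  have hL0 : 0 ≤ Real.log β := Real.log_nonneg (by linarith)
  have hn0 : (0 : ℝ) < n := by exact_mod_cast hn
  set x : ℝ := ((n' : ℝ) - n) / n with hx
  have hx0 : 0 ≤ x := by rw [hx]; exact div_nonneg (sub_nonneg.2 (by exact_mod_cast h1)) hn0.le
  set φ : ℝ := ((n' : ℝ) / n) ^ d with hφ
  have hφF := B.mul_F_le_F hβ0.le hn h1
  have hφ1 : 1 ≤ φ := one_le_pow₀ (by rw [le_div_iff₀ hn0, one_mul]; exact_mod_cast h1)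
  have hφsub : φ - 1 ≤ d * 2 ^ (d - 1) * x := div_pow_sub_one_le (d := d) hn h1 h2
  have hKT := B.abs_T_le hβ2 n'
  have hK0 := B.Kc_nonneg
  have hθT := sub_abs_mul_le_theta_mul φ (B.T n' β)
  rw [abs_of_nonneg (by linarith : 0 ≤ φ - 1)] at hθT
  have hcs := coef_sub_coef_le (d := d) hd hn h1
  have hcn' := coef_le (d := d) n'
  have hcn'0 := coef_nonneg (d := d) n'
  have hN2 : (0 : ℝ) ≤ (B.D : ℝ) := Nat.cast_nonneg _
  -- `T n ≥ φ T n' - (φ coef n' - coef n)/2 D L`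
  have hTn : φ * B.T n' β - (φ * coef d n' - coef d n) / 2 * (B.D : ℝ) * Real.log β ≤ B.T n β := by
    have e : B.T n β = B.F n β + coef d n / 2 * (B.D : ℝ) * Real.log β := rfl
    have e' : B.T n' β = B.F n' β + coef d n' / 2 * (B.D : ℝ) * Real.log β := rfl
    rw [e, e']; linarith
  have p1 : (φ - 1) * |B.T n' β| ≤ (d * 2 ^ (d - 1) * x) * (B.Kc * Real.log β) :=
    mul_le_mul hφsub hKT (abs_nonneg _) (by positivity)
  have hc2 : φ * coef d n' - coef d n ≤ (d * 2 ^ (d - 1) * x) * d + d * x := by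
    have e1 : (φ - 1) * coef d n' ≤ (d * 2 ^ (d - 1) * x) * d := by
      calc (φ - 1) * coef d n' ≤ (d * 2 ^ (d - 1) * x) * coef d n' := by gcongr
        _ ≤ (d * 2 ^ (d - 1) * x) * d := by gcongr
    nlinarith
  have p2 : (φ * coef d n' - coef d n) / 2 * (B.D : ℝ) * Real.log β ≤
      ((d * 2 ^ (d - 1) * x) * d + d * x) / 2 * (B.D : ℝ) * Real.log β := by gcongr
  have hK3 : B.K₃ * x * Real.log β =
      (d * 2 ^ (d - 1) * x) * (B.Kc * Real.log β) +
        ((d * 2 ^ (d - 1) * x) * d + d * x) / 2 * (B.D : ℝ) * Real.log β := by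
    unfold OneBoxBounds.K₃; ring
  rw [hK3]
  linarith

/-- The junk term of `F_ge_of_ge` is `O(β/n'')`: with `s = n''+1 ≤ n` and `k s ≤ n + s`,
`βP₅D(k/n)^d(2n''^{d-1} + s^d - n''^d) ≤ 2^d(d+2)P₅d²β/s`. [cite: arXiv160201222, Lemma 17.5] -/
theorem junk_le (hd : 1 ≤ d) {β : ℝ} (hβ : 0 ≤ β) {n'' n k : ℕ} (hn'' : 1 ≤ n'') (hn : n'' + 1 ≤ n)
    (hks2 : (k : ℝ) * ((n'' : ℝ) + 1) ≤ n + ((n'' : ℝ) + 1)) :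
    β * B.P₅ * Fintype.card {q : Fin d × Fin d // q.1 < q.2} * ((k : ℝ) / n) ^ d *
        (2 * (n'' : ℝ) ^ (d - 1) + (((n'' : ℝ) + 1) ^ d - (n'' : ℝ) ^ d)) ≤
      2 ^ d * ((d : ℝ) + 2) * B.P₅ * (d : ℝ) ^ 2 * β / ((n'' : ℝ) + 1) := by
  set D : ℝ := (Fintype.card {q : Fin d × Fin d // q.1 < q.2} : ℝ) with hD
  have hDle : D ≤ (d : ℝ) ^ 2 := card_planes_le
  have hP := B.P₅_nonneg
  have hn1 : 1 ≤ n := le_trans (by omega) hn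
  have hn0 : (0 : ℝ) < n := by exact_mod_cast hn1
  have hs0 : (0 : ℝ) < (n'' : ℝ) + 1 := by positivity
  have hn''0 : (0 : ℝ) < n'' := by exact_mod_cast hn''
  have hsn : (n'' : ℝ) + 1 ≤ n := by exact_mod_cast hn
  have hk0 : (0 : ℝ) ≤ k := Nat.cast_nonneg k
  have hkn : (k : ℝ) / n ≤ 2 / ((n'' : ℝ) + 1) := by
    rw [div_le_div_iff₀ hn0 hs0]; nlinarith
  have hkn0 : 0 ≤ (k : ℝ) / n := by positivity
  have hpow1 : ((k : ℝ) / n) ^ d ≤ (2 / ((n'' : ℝ) + 1)) ^ d := pow_le_pow_left₀ hkn0 hkn d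
  have hs1 : (n'' : ℝ) ^ (d - 1) ≤ ((n'' : ℝ) + 1) ^ (d - 1) :=
    pow_le_pow_left₀ hn''0.le (by linarith) _
  have hdiff : ((n'' : ℝ) + 1) ^ d - (n'' : ℝ) ^ d ≤ d * ((n'' : ℝ) + 1) ^ (d - 1) := by
    have := pow_sub_pow_le (s := (n'' : ℝ) + 1) (by linarith) d
    rwa [add_sub_cancel_right] at this
  have hsum : 2 * (n'' : ℝ) ^ (d - 1) + (((n'' : ℝ) + 1) ^ d - (n'' : ℝ) ^ d) ≤
      ((d : ℝ) + 2) * ((n'' : ℝ) + 1) ^ (d - 1) := by nlinarith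
  have hsum0 : 0 ≤ 2 * (n'' : ℝ) ^ (d - 1) + (((n'' : ℝ) + 1) ^ d - (n'' : ℝ) ^ d) := by
    have : (n'' : ℝ) ^ d ≤ ((n'' : ℝ) + 1) ^ d := pow_le_pow_left₀ hn''0.le (by linarith) d
    have : 0 ≤ (n'' : ℝ) ^ (d - 1) := by positivity
    linarith
  have hsplit : ((n'' : ℝ) + 1) ^ d = ((n'' : ℝ) + 1) * ((n'' : ℝ) + 1) ^ (d - 1) := by
    rw [← pow_succ']; congr 1; omega
  have hpow2 : (2 / ((n'' : ℝ) + 1)) ^ d * ((n'' : ℝ) + 1) ^ (d - 1) = 2 ^ d / ((n'' : ℝ) + 1) := by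
    rw [div_pow, hsplit]; field_simp
  calc β * B.P₅ * D * ((k : ℝ) / n) ^ d * (2 * (n'' : ℝ) ^ (d - 1) + (((n'' : ℝ) + 1) ^ d - (n'' : ℝ) ^ d))
      ≤ β * B.P₅ * (d : ℝ) ^ 2 * (2 / ((n'' : ℝ) + 1)) ^ d *
          (((d : ℝ) + 2) * ((n'' : ℝ) + 1) ^ (d - 1)) := by
        gcongr
    _ = ((d : ℝ) + 2) * B.P₅ * (d : ℝ) ^ 2 * β *
          ((2 / ((n'' : ℝ) + 1)) ^ d * ((n'' : ℝ) + 1) ^ (d - 1)) := by ring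
    _ = 2 ^ d * ((d : ℝ) + 2) * B.P₅ * (d : ℝ) ^ 2 * β / ((n'' : ℝ) + 1) := by
        rw [hpow2]; ring

/-- **Going down in the side length** (Lemma 17.5): for `β ≥ 2`, `1 ≤ n''`, `s = n'' + 1 ≤ n`,
`T(B_n, β) ≥ T(B_{n''}, β) - ((d/s + d2^{d-1}s/n)(K + dD/2) + (d+1)D/s) log β - 2^d(d+2)P₅d²β/s`. [cite: arXiv160201222, Lemma 17.7 (proof), Lemma 17.5] -/
theorem T_sub_le_T_of_ge {β : ℝ} (hβ2 : 2 ≤ β) (hd : 1 ≤ d) {n'' n : ℕ} (hn'' : 1 ≤ n'')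
    (hn : n'' + 1 ≤ n) :
    B.T n'' β -
        (((d : ℝ) / ((n'' : ℝ) + 1) + d * 2 ^ (d - 1) * (((n'' : ℝ) + 1) / n)) * (B.Kc + d * (B.D : ℝ) / 2) +
            ((d : ℝ) + 1) * (B.D : ℝ) / ((n'' : ℝ) + 1)) * Real.log β -
        2 ^ d * ((d : ℝ) + 2) * B.P₅ * (d : ℝ) ^ 2 * β / ((n'' : ℝ) + 1) ≤
      B.T n β := by
  have hβ0 : 0 < β := by linarith
  have hL0 : 0 ≤ Real.log β := Real.log_nonneg (by linarith)
  have hn1 : 1 ≤ n := le_trans (by omega) hn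
  have hn0 : (0 : ℝ) < n := by exact_mod_cast hn1
  have hs0 : (0 : ℝ) < (n'' : ℝ) + 1 := by positivity
  have hn''0 : (0 : ℝ) < n'' := by exact_mod_cast hn''
  have hF := B.F_ge_of_ge hβ0.le hn'' hn
  set k : ℕ := n / (n'' + 1) + 1 with hk
  -- `k s ∈ [n, n + s]`
  have hks1 : (n : ℝ) ≤ (k : ℝ) * ((n'' : ℝ) + 1) := by
    have h := Nat.lt_div_mul_add (a := n) (b := n'' + 1) (by omega)
    have : n ≤ k * (n'' + 1) := by
      rw [hk, Nat.add_mul, one_mul]; exact h.le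
    exact_mod_cast this
  have hks2 : (k : ℝ) * ((n'' : ℝ) + 1) ≤ n + ((n'' : ℝ) + 1) := by
    have : k * (n'' + 1) ≤ n + (n'' + 1) := by
      rw [hk, Nat.add_mul, one_mul]
      exact Nat.add_le_add_right (Nat.div_mul_le_self n (n'' + 1)) _
    exact_mod_cast this
  have hkreal : (((n / (n'' + 1) : ℕ) : ℝ) + 1) = (k : ℝ) := by rw [hk]; push_cast; ring
  rw [hkreal] at hF
  have hJ1 := B.junk_le hd hβ0.le hn'' hn hks2
  have hθabs := abs_theta'_sub_one_le (d := d) hn'' hn hks1 hks2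
  generalize hJ : β * B.P₅ * Fintype.card {q : Fin d × Fin d // q.1 < q.2} * ((k : ℝ) / n) ^ d *
        (2 * (n'' : ℝ) ^ (d - 1) + (((n'' : ℝ) + 1) ^ d - (n'' : ℝ) ^ d)) = J at hF hJ1
  generalize hθ : ((k : ℝ) * n'' / n) ^ d = θ at hF hθabs
  generalize hy : (d : ℝ) / ((n'' : ℝ) + 1) + d * 2 ^ (d - 1) * (((n'' : ℝ) + 1) / n) = y at hθabs ⊢
  have hy0 : 0 ≤ y := le_trans (abs_nonneg _) hθabs
  -- assemble
  have hKT := B.abs_T_le hβ2 n''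
  have hK0 := B.Kc_nonneg
  have hθT := sub_abs_mul_le_theta_mul θ (B.T n'' β)
  have hcabs := abs_coef_sub_le (d := d) hd hn'' (show n'' ≤ n by omega)
  have hcn''le := coef_le (d := d) n''
  have hcn''0 := coef_nonneg (d := d) n''
  have hN2 : (0 : ℝ) ≤ (B.D : ℝ) := Nat.cast_nonneg _
  have hTn : θ * B.T n'' β - (θ * coef d n'' - coef d n) / 2 * (B.D : ℝ) * Real.log β - J ≤
      B.T n β := by
    have e : B.T n β = B.F n β + coef d n / 2 * (B.D : ℝ) * Real.log β := rfl
    have e' : B.T n'' β = B.F n'' β + coef d n'' / 2 * (B.D : ℝ) * Real.log β := rfl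
    rw [e, e']; linarith
  have p1 : |θ - 1| * |B.T n'' β| ≤ y * (B.Kc * Real.log β) :=
    mul_le_mul hθabs hKT (abs_nonneg _) hy0
  have h1s : 1 / (n'' : ℝ) ≤ 2 / ((n'' : ℝ) + 1) := by
    rw [div_le_div_iff₀ hn''0 hs0]; have : (1:ℝ) ≤ n'' := by exact_mod_cast hn''
    linarith
  have hc2 : |θ * coef d n'' - coef d n| ≤ y * d + 2 * ((d : ℝ) + 1) / ((n'' : ℝ) + 1) := by
    have e1 : |(θ - 1) * coef d n''| ≤ y * d := by
      rw [abs_mul, abs_of_nonneg hcn''0]; exact mul_le_mul hθabs hcn''le hcn''0 hy0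
    have e2 : |coef d n'' - coef d n| ≤ 2 * ((d : ℝ) + 1) / ((n'' : ℝ) + 1) := by
      rw [abs_sub_comm]
      calc |coef d n - coef d n''| ≤ ((d : ℝ) + 1) / n'' := hcabs
        _ = ((d : ℝ) + 1) * (1 / n'') := by ring
        _ ≤ ((d : ℝ) + 1) * (2 / ((n'' : ℝ) + 1)) := by gcongr
        _ = 2 * ((d : ℝ) + 1) / ((n'' : ℝ) + 1) := by ring
    calc |θ * coef d n'' - coef d n| = |(θ - 1) * coef d n'' + (coef d n'' - coef d n)| := by ring_nf
      _ ≤ |(θ - 1) * coef d n''| + |coef d n'' - coef d n| := abs_add_le _ _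
      _ ≤ _ := add_le_add e1 e2
  have p2 : |(θ * coef d n'' - coef d n) / 2 * (B.D : ℝ) * Real.log β| ≤
      (y * d + 2 * ((d : ℝ) + 1) / ((n'' : ℝ) + 1)) / 2 * (B.D : ℝ) * Real.log β := by
    rw [abs_mul, abs_mul, abs_div, abs_of_nonneg hN2, abs_of_nonneg hL0, abs_two]
    gcongr
  have p3 := le_abs_self ((θ * coef d n'' - coef d n) / 2 * (B.D : ℝ) * Real.log β)
  have heq : (y * (B.Kc + d * (B.D : ℝ) / 2) + ((d : ℝ) + 1) * (B.D : ℝ) / ((n'' : ℝ) + 1)) * Real.log β =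
      y * (B.Kc * Real.log β) +
        (y * d + 2 * ((d : ℝ) + 1) / ((n'' : ℝ) + 1)) / 2 * (B.D : ℝ) * Real.log β := by
    ring
  rw [heq]
  linarith

/-! ### Lemma 17.7: error majorants and their limits -/

/-- The common error `coef(n) D log κ(r) + Aβr³d² ≤ e₀(β) = K_κ dDβ^{-2/5} + Ad²β^{-1/5}` at
`r = β^{-2/5} ≤ r₁`. [cite: arXiv160201222, Lemma 17.6 (proof, `c = 2/5`)] -/
theorem common_err_le {β : ℝ} (hβ : 0 < β) (hr1 : β ^ (-(2 / 5 : ℝ)) ≤ B.r₁) (n : ℕ) :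
    coef d n * (B.D : ℝ) * Real.log (B.κ (β ^ (-(2 / 5 : ℝ)))) +
        B.A * β * (β ^ (-(2 / 5 : ℝ))) ^ 3 * ((d : ℝ) * d) ≤ B.e0 β := by
  unfold OneBoxBounds.e0
  set r := β ^ (-(2 / 5 : ℝ)) with hr
  have hr0 : 0 ≤ r := Real.rpow_nonneg hβ.le _
  have hlog := B.log_κ_le r hr0 hr1
  have hc := coef_le (d := d) n
  have hc0 := coef_nonneg (d := d) n
  have hD : (0 : ℝ) ≤ (B.D : ℝ) := Nat.cast_nonneg _
  have hK := B.Kκ_nonneg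
  have h1 : coef d n * (B.D : ℝ) * Real.log (B.κ r) ≤ B.Kκ * d * (B.D : ℝ) * r := by
    calc coef d n * (B.D : ℝ) * Real.log (B.κ r) ≤ coef d n * (B.D : ℝ) * (B.Kκ * r) := by
          exact mul_le_mul_of_nonneg_left hlog (by positivity)
      _ ≤ d * (B.D : ℝ) * (B.Kκ * r) := by gcongr
      _ = B.Kκ * d * (B.D : ℝ) * r := by ring
  have h2 : B.A * β * r ^ 3 * ((d : ℝ) * d) = B.A * (d : ℝ) ^ 2 * β ^ (-(1 / 5 : ℝ)) := by
    rw [← mul_r_cube_eq hβ, hr]; ring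
  linarith

/-- `e₀(β) → 0`. [folklore] -/
theorem tendsto_e0 : Tendsto B.e0 atTop (𝓝 0) := by
  have h1 : Tendsto (fun β : ℝ => β ^ (-(2 / 5 : ℝ))) atTop (𝓝 0) :=
    tendsto_rpow_neg_atTop (by norm_num)
  have h2 : Tendsto (fun β : ℝ => β ^ (-(1 / 5 : ℝ))) atTop (𝓝 0) :=
    tendsto_rpow_neg_atTop (by norm_num)
  have h := (h1.const_mul (B.Kκ * d * (B.D : ℝ))).add (h2.const_mul (B.A * (d : ℝ) ^ 2))
  simp only [mul_zero, add_zero] at h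
  exact h.congr' (Eventually.of_forall fun β => by simp only [OneBoxBounds.e0])

/-- `err_LB(β) → 0`. [folklore] -/
theorem tendsto_errLB : Tendsto B.errLB atTop (𝓝 0) := by
  have hb := bL_pos (d := d)
  have h1 : Tendsto (fun β : ℝ => 2 * Real.log 2 / β ^ bL d) atTop (𝓝 0) :=
    tendsto_const_nhds.div_atTop (tendsto_rpow_atTop hb)
  have h2 : Tendsto (fun β : ℝ => Bbar d β / β ^ bL d) atTop (𝓝 0) := by
    have hl := tendsto_log_div_rpow' (s := bL d) hb
    have hc : Tendsto (fun β : ℝ => ((2 * d + 1) * Real.log 3 + (Real.log d + 8 * (d : ℝ) ^ 2 + 2)) /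
        β ^ bL d) atTop (𝓝 0) :=
      tendsto_const_nhds.div_atTop (tendsto_rpow_atTop hb)
    have := hc.add (hl.const_mul ((2 * (d : ℝ) + 1) * 3))
    simp only [zero_add, mul_zero] at this
    refine this.congr' (Eventually.of_forall fun β => ?_)
    simp only [Bbar]; ring
  have := (h1.add (h2.const_mul (8 * (d : ℝ) ^ 2))).const_mul (B.D : ℝ)
  simp only [mul_zero, add_zero] at this
  refine this.congr' (Eventually.of_forall fun β => ?_)
  simp only [OneBoxBounds.errLB]; ring

/-- `J_D(β) → 0`. [folklore] -/
theorem tendsto_JD : Tendsto B.JD atTop (𝓝 0) := by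
  have hb := bL_pos (d := d)
  have hb1 := bL_lt_one (d := d)
  have h1 : Tendsto (fun β : ℝ => Real.log β / β ^ 2) atTop (𝓝 0) := by
    have := tendsto_log_div_rpow' (s := 2) (by norm_num)
    refine this.congr' (Eventually.of_forall fun β => ?_); norm_num
  have h2 : Tendsto (fun β : ℝ => (β ^ bL d / β) * Real.log β) atTop (𝓝 0) := by
    have := tendsto_rpow_mul_log (p := bL d - 1) (by linarith)
    refine this.congr' ?_
    filter_upwards [eventually_gt_atTop 0] with β hβ
    rw [Real.rpow_sub_one hβ.ne']
  have h3 : Tendsto (fun β : ℝ => (1 : ℝ) / β) atTop (𝓝 0) := tendsto_const_nhds.div_atTop tendsto_id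
  have h1' : Tendsto (fun β : ℝ => (1 / β ^ 2) * Real.log β) atTop (𝓝 0) := by
    refine h1.congr' (Eventually.of_forall fun β => ?_); ring
  have := ((((h1'.const_mul (d : ℝ)).add (h2.const_mul (3 * (d : ℝ) * 2 ^ (d - 1)))).mul_const
    (B.Kc + d * (B.D : ℝ) / 2)).add (h1.const_mul (((d : ℝ) + 1) * (B.D : ℝ)))).add
    (h3.const_mul (2 ^ d * ((d : ℝ) + 2) * B.P₅ * (d : ℝ) ^ 2))
  simp only [mul_zero, zero_mul, add_zero] at this
  refine this.congr' (Eventually.of_forall fun β => ?_)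
  simp only [OneBoxBounds.JD]; ring

/-! ### Lemma 17.7: the three regimes -/

/-- `√β r/ν = β^{1/10}/ν` at `r = β^{-2/5}`. [folklore] -/
theorem Rprime_eq {β : ℝ} (hβ : 0 < β) :
    Real.sqrt β * β ^ (-(2 / 5 : ℝ)) / B.ν = β ^ (1 / 10 : ℝ) / B.ν := by
  rw [sqrt_mul_r_eq hβ]

/-- **Regime A (`n ≤ β^c`)**: the union bound supplies `L = 1/2`, and
`T(B_n, β) ≥ G(n) - e₀(β) - D log 2/n^d`. [cite: arXiv160201222, Lemma 17.6] -/
theorem lowA (hd : 1 ≤ d) {β : ℝ} (hβ2 : 2 ≤ β) (hr1 : β ^ (-(2 / 5 : ℝ)) ≤ B.r₁)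
    (hW : Wfun d (cL d) β / β ^ (1 / 5 : ℝ) ≤ 1 / B.ν ^ 2) {n : ℕ} (hn1 : 1 ≤ n)
    (hn : (n : ℝ) ≤ β ^ cL d) :
    B.Gm n - B.e0 β - (B.D : ℝ) * (Real.log 2 / (n : ℝ) ^ d) ≤ B.T n β := by
  have hβ0 : 0 < β := by linarith
  have hβ1 : 1 ≤ β := by linarith
  have hN0 : (0 : ℝ) < B.ν := lt_of_lt_of_le one_pos B.one_le_ν
  set r := β ^ (-(2 / 5 : ℝ)) with hr
  have hr0 : 0 < r := Real.rpow_pos_of_pos hβ0 _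
  have hβ5 : 0 < β ^ (1 / 5 : ℝ) := Real.rpow_pos_of_pos hβ0 _
  -- `R_z(n) ≤ β^{1/10}/ν`
  have hWle : Wfun d (cL d) β ≤ β ^ (1 / 5 : ℝ) / B.ν ^ 2 := by
    rw [div_le_iff₀ hβ5] at hW; rw [div_eq_mul_one_div, mul_comm]; exact hW
  have hRz2 : Rz d n ^ 2 ≤ β ^ (1 / 5 : ℝ) / B.ν ^ 2 := by
    rw [Rz, Real.sq_sqrt (div_nonneg (mul_nonneg zero_le_two (Real.log_nonneg (by
      have : (0:ℝ) ≤ 4 * ((d : ℝ) * (n : ℝ) ^ d) := by positivity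
      linarith))) cLow_pos.le)]
    exact (Rz_sq_le_Wfun (d := d) hd hβ1 hn1 hn).trans hWle
  have hx : Rz d n ≤ Real.sqrt β * r / B.ν := by
    rw [hr, B.Rprime_eq hβ0]
    have h10 : β ^ (1 / 10 : ℝ) / B.ν = Real.sqrt (β ^ (1 / 5 : ℝ) / B.ν ^ 2) := by
      rw [Real.sqrt_div' _ (by positivity), Real.sqrt_sq hN0.le, Real.sqrt_eq_rpow,
        ← Real.rpow_mul hβ0.le]
      norm_num
    rw [h10]
    exact (Real.le_sqrt (Rz_nonneg n) (by positivity)).2 hRz2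
  have h := B.G_sub_le_T_small hβ2 hn1 hr0 hr1 hx
  have hc := B.common_err_le hβ0 hr1 n
  rw [← hr] at hc
  linarith

end OneBoxBounds

end Summit.QuantumFields.YangMills.Theorems.FreeEnergyLogCoefficient

end
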